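import Summits.ResolutionOfSingularities.ResolutionOfSingularities.Theorems.MarkedTransferCampaignW24ReducedBridgePIffOne
import HarnessLib

/-!
# The LEVEL-`q` bridge at an ARBITRARY PRIME `p`, part 8: the equivalence for EVERY one-variable carrier presented as «top residue class +
# passenger» (HIRONAKA-L · cell `res-hironaka` · slot W2.4 «bottom-member re-run»; generalises the twin-carrier equivalences of
# `…ReducedBridgePIff.lean` / `…PIffOne.lean` to carriers with a passenger, e.g. every polynomial `P` with `q < ord P`, decomposed as in `…PSlice`)

**HONEST FRAMING.** OURS throughout: kernel theorems connecting OURS objects of the cell (res-L1-k24's `CampaignW24.ReducedRun`, res-type-059's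
`CampaignW24.StaysInBox`, res-D-pv-020's `CampaignW24.ReducedBridge(P)`). Nothing below is a statement of H. Hironaka's manuscript [Hironaka2017]
(lit key `paper:url-3343fd9e678b`), nothing asserts that any statement of it holds, nothing is a claim about resolution of singularities in
characteristic `p`; the manuscript stays «under review» (D-0012/D-0089). AI work, weaker than expert review. Written by res-D-pv-020 (W2.4 lineage).

## What is proved (`K` of characteristic `p` with the premise binders; `0 < e`; `q = p^e`; `F = Φ_{q,r₀} G + R` with `r₀ < q`, `p ∤ r₀`,
## `G ≠ 0`, `R` a passenger whose residues lie in `good ⊆ PairLTP p · r₀` and are all visible in `F`; `q < ord F`)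
* **`carrierStaysInBox_iff_of_top_class`** (`2 ≤ ord G`): `Rescue.CarrierStaysInBox p e F ↔` the canonical reduced run of `G` is exhausted in
  box at infinitely many `p`-power depths.
* **`carrierStaysInBox_iff_of_top_class_digitOne`** (`ord G = 1`, `G` supported below `B`): the same with `G₁ = univStepIIIq (q / r₀ + 1) G`.
So on `n = 1`, at every prime, the OURS premise for such a carrier depends ONLY on the reduced run of its top residue class — the passenger is
irrelevant. (Every polynomial `P` with a reference datum meeting the provisos is of this form: `…PSlice`, proof of
`carrierStaysInBox_coe_fin_one_of_reduced_exhaustion`.) Hypotheses: each theorem's own binders; no FACT-LIST fact, no DEFECT binder.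
Standard axioms only.
-/

noncomputable section

set_option linter.dupNamespace false -- mandated namespace of this single-conjunct summit

namespace Summit.ResolutionOfSingularities.ResolutionOfSingularities.Theorems

namespace CampaignW24

namespace ReducedBridgeP

open Literature.AlgebraicGeometry.Hironaka2017.S08UnitMonomial (StandardExpression nonempty_standardExpression_topFrame)
open Literature.AlgebraicGeometry.Hironaka2017.S09LLUED
open Literature.AlgebraicGeometry.Hironaka2017.S09LLUED.TopFrontier
open Literature.AlgebraicGeometry.Resolution (adicOrder)
open CampaignW21 (xs hasseD)
open ReducedBridge

variable {K : Type} [Field K] {p : ℕ} [hp : Fact p.Prime] [CharP K p]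

omit [CharP K p] in
/-- A carrier with a live top residue class is non-zero. [folklore] -/
theorem ne_zero_of_top_class {e r₀ : ℕ} (hr₀ : r₀ < p ^ e) {good : ℕ → Prop} (hgood : ∀ ρ, good ρ → PairLTP p ρ r₀)
    {F R : MvPowerSeries (Fin 1) K} {G : PowerSeries K} (hF : F = phiQ (p ^ e) (ppow_ne_zero p e) r₀ G + R)
    (hR : ResIn (p ^ e) good R) (hG : G ≠ 0) : F ≠ 0 := by
  obtain ⟨k, hk⟩ : ∃ k, PowerSeries.coeff k G ≠ 0 := by
    by_contra h
    push Not at h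
    exact hG (PowerSeries.ext fun k => by rw [h k, map_zero])
  intro hF0
  apply hk
  rw [← coeff_top_residueP hF hr₀ hR hgood k, hF0, map_zero]

/-- **THE EQUIVALENCE FOR A CARRIER WITH A PASSENGER, bottom digit `≥ 2`.** With the binders of the module docstring:
`Rescue.CarrierStaysInBox p e F ↔ ∀ a₀, ∃ a ≥ a₀, ∃ i₁, (∀ i < i₁, canonRun p^a G i ≠ 0 ∧ 2 ≤ ord < p^a) ∧ canonRun p^a G i₁ = 0` — the passenger
is irrelevant. (←) `…PSlice`'s confinement from exhaustion; (→) die-or-escape (`…PIff`) and `…PEscape`'s refutation under escapes, at the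
reference datum of depth `e + a₀` that exists over a perfect field. OURS objects; nothing about the manuscript. [folklore] -/
theorem carrierStaysInBox_iff_of_top_class [ExpChar K p] [PerfectRing K p] {e : ℕ} (he : 0 < e) {r₀ : ℕ} (hr₀ : r₀ < p ^ e)
    (hr₀p : r₀ % p ≠ 0) {good : ℕ → Prop} (hgood : ∀ ρ, good ρ → PairLTP p ρ r₀) {F R : MvPowerSeries (Fin 1) K} {G : PowerSeries K}
    (hF : F = phiQ (p ^ e) (ppow_ne_zero p e) r₀ G + R) (hR : ResIn (p ^ e) good R)
    (hvis : ∀ ρ, good ρ → ∃ d : Fin 1 →₀ ℕ, MvPowerSeries.coeff d F ≠ 0 ∧ d 0 % p ^ e = ρ) (hG : G ≠ 0)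
    (h2 : (2 : ℕ∞) ≤ PowerSeries.order G) (hord : ((p ^ e : ℕ) : ℕ∞) < adicOrder F) :
    Rescue.CarrierStaysInBox p e F ↔
      ∀ a₀ : ℕ, ∃ a : ℕ, a₀ ≤ a ∧ ∃ i₁ : ℕ,
        (∀ i < i₁, ReducedRun.canonRun (p ^ a) G i ≠ 0 ∧ (2 : ℕ∞) ≤ PowerSeries.order (ReducedRun.canonRun (p ^ a) G i) ∧
          PowerSeries.order (ReducedRun.canonRun (p ^ a) G i) < ((p ^ a : ℕ) : ℕ∞)) ∧
        ReducedRun.canonRun (p ^ a) G i₁ = 0 := by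
  constructor
  · intro h
    haveI : PerfectField K := PerfectRing.toPerfectField K p
    by_contra hex
    push Not at hex
    obtain ⟨a₀, ha₀⟩ := hex
    obtain ⟨X₀⟩ := nonempty_standardExpression_topFrame (p := p) K 1 e (e + a₀) F
    have h00 : 0 < frontierLength X₀.support X₀.u := frontierLength_pos_of_ne_zero X₀ (ne_zero_of_top_class hr₀ hgood hF hR hG)
    obtain ⟨hα, -⟩ := alpha_beta_of_levelP X₀ hF hr₀ hR hgood he (by omega) hG
    have hαne : alpha X₀.support X₀.u ≠ 0 := by rw [hα]; exact Finsupp.single_ne_zero.mpr hr₀p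
    obtain ⟨ℓ, hℓ, hstay⟩ := h (e + a₀) X₀ he (by omega) h00 hαne hord
    obtain ⟨i₁, hpre, hend⟩ := reduced_run_dichotomy (p := p) (ℓ - e) h2
    rcases hend with hzero | ⟨hne, hP⟩
    · exact ha₀ (ℓ - e) (by omega) i₁ hpre hzero
    · exact not_staysInBox_of_escapeP he (by omega) hℓ hr₀ hgood hG X₀ hF hR h00 hαne hord
        (fun i hi => ⟨(hpre i hi).1, (hpre i hi).2.1⟩) ⟨hne, hP⟩ hstay
  · intro hex ℓ₀ X₀ _ hle h0 _ _
    obtain ⟨a, ha, i₁, hpre, hzero⟩ := hex ℓ₀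
    refine ⟨e + a, by omega, ?_⟩
    have hae : e + a - e = a := by omega
    refine staysInBox_of_level_of_reduced_exhaustionP he (by omega) hr₀ hgood hG X₀ hF hR hle hvis (i₁ := i₁) ?_ ?_
    · rw [hae]; exact hpre
    · rw [hae]; exact hzero

/-- **THE EQUIVALENCE FOR A CARRIER WITH A PASSENGER, bottom digit `1`** (`ord G = 1`, `G` supported below `B`, `G₁ = univStepIIIq (q / r₀ + 1) G`):
`Rescue.CarrierStaysInBox p e F ↔` the canonical reduced run of `G₁` is exhausted in box at infinitely many `p`-power depths. OURS objects;
nothing about the manuscript. [folklore] -/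
theorem carrierStaysInBox_iff_of_top_class_digitOne [ExpChar K p] [PerfectRing K p] {e : ℕ} (he : 0 < e) {r₀ : ℕ} (hr₀ : r₀ < p ^ e)
    (hr₀p : r₀ % p ≠ 0) {good : ℕ → Prop} (hgood : ∀ ρ, good ρ → PairLTP p ρ r₀) {F R : MvPowerSeries (Fin 1) K} {G : PowerSeries K}
    (hF : F = phiQ (p ^ e) (ppow_ne_zero p e) r₀ G + R) (hR : ResIn (p ^ e) good R)
    (hvis : ∀ ρ, good ρ → ∃ d : Fin 1 →₀ ℕ, MvPowerSeries.coeff d F ≠ 0 ∧ d 0 % p ^ e = ρ) (hk : PowerSeries.order G = (1 : ℕ))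
    {B : ℕ} (hB : ∀ m, B < m → PowerSeries.coeff m G = 0) (hord : ((p ^ e : ℕ) : ℕ∞) < adicOrder F) :
    Rescue.CarrierStaysInBox p e F ↔
      ∀ a₀ : ℕ, ∃ a : ℕ, a₀ ≤ a ∧ ∃ i₁ : ℕ,
        (∀ i < i₁, ReducedRun.canonRun (p ^ a) (ReducedRun.univStepIIIq (p ^ e / r₀ + 1) G) i ≠ 0 ∧
          (2 : ℕ∞) ≤ PowerSeries.order (ReducedRun.canonRun (p ^ a) (ReducedRun.univStepIIIq (p ^ e / r₀ + 1) G) i) ∧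
          PowerSeries.order (ReducedRun.canonRun (p ^ a) (ReducedRun.univStepIIIq (p ^ e / r₀ + 1) G) i) < ((p ^ a : ℕ) : ℕ∞)) ∧
        ReducedRun.canonRun (p ^ a) (ReducedRun.univStepIIIq (p ^ e / r₀ + 1) G) i₁ = 0 := by
  have hG : G ≠ 0 := fun h => by rw [h, PowerSeries.order_zero] at hk; exact ENat.top_ne_coe _ hk
  have hG0 : PowerSeries.constantCoeff G = 0 := by
    rw [← PowerSeries.coeff_zero_eq_constantCoeff_apply]; exact (PowerSeries.order_eq_nat.mp hk).2 0 Nat.one_pos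
  have hr₀pos : 0 < r₀ := Nat.pos_of_ne_zero fun h0 => hr₀p (by rw [h0, Nat.zero_mod])
  have h2 : (2 : ℕ∞) ≤ PowerSeries.order (ReducedRun.univStepIIIq (p ^ e / r₀ + 1) G) := ReducedRun.two_le_order_univStepIIIq _ hG0
  constructor
  · intro h
    haveI : PerfectField K := PerfectRing.toPerfectField K p
    by_contra hex
    push Not at hex
    obtain ⟨a₀, ha₀⟩ := hex
    obtain ⟨X₀⟩ := nonempty_standardExpression_topFrame (p := p) K 1 e (e + max a₀ (B + 1)) F
    have h00 : 0 < frontierLength X₀.support X₀.u := frontierLength_pos_of_ne_zero X₀ (ne_zero_of_top_class hr₀ hgood hF hR hG)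
    obtain ⟨hα, -⟩ := alpha_beta_of_levelP X₀ hF hr₀ hR hgood he (by omega) hG
    have hαne : alpha X₀.support X₀.u ≠ 0 := by rw [hα]; exact Finsupp.single_ne_zero.mpr hr₀p
    obtain ⟨ℓ, hℓ, hstay⟩ := h (e + max a₀ (B + 1)) X₀ he (by omega) h00 hαne hord
    have hBP : B < p ^ (ℓ - e) :=
      lt_of_lt_of_le (Nat.lt_pow_self hp.out.one_lt) (Nat.pow_le_pow_right hp.out.pos (show B ≤ ℓ - e by omega))
    have hcanon : ReducedRun.canonStepIIIq (p ^ (ℓ - e)) (p ^ e / r₀ + 1) G = ReducedRun.univStepIIIq (p ^ e / r₀ + 1) G :=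
      ReducedRun.canonStepIIIq_eq_univStepIIIq fun m hm => hB m (by omega)
    obtain ⟨i₁, hpre, hend⟩ := reduced_run_dichotomy (p := p) (ℓ - e) h2
    rcases hend with hzero | ⟨hne, hP⟩
    · exact ha₀ (ℓ - e) (by omega) i₁ hpre hzero
    · refine not_staysInBox_of_escape_digitOneP he (by omega) hℓ hr₀ hr₀pos hgood hk X₀ hF hR h00 hαne hord (i₁ := i₁) ?_ ?_ hstay
      · rw [hcanon]; exact fun i hi => ⟨(hpre i hi).1, (hpre i hi).2.1⟩
      · rw [hcanon]; exact ⟨hne, hP⟩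
  · intro hex ℓ₀ X₀ _ hle h0 _ _
    obtain ⟨a, ha, i₁, hpre, hzero⟩ := hex (max ℓ₀ (B + 1))
    refine ⟨e + a, by omega, ?_⟩
    have hae : e + a - e = a := by omega
    have hBP : B < p ^ a := lt_of_lt_of_le (Nat.lt_pow_self hp.out.one_lt) (Nat.pow_le_pow_right hp.out.pos (show B ≤ a by omega))
    have hcanon : ReducedRun.canonStepIIIq (p ^ (e + a - e)) (p ^ e / r₀ + 1) G = ReducedRun.univStepIIIq (p ^ e / r₀ + 1) G := by
      rw [hae]; exact ReducedRun.canonStepIIIq_eq_univStepIIIq fun m hm => hB m (by omega)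
    refine staysInBox_of_level_of_reduced_exhaustion_digitOneP he (by omega) hr₀ hr₀pos hgood hk X₀ hF hR hle hvis (i₁ := i₁) ?_ ?_
    · intro i hi
      rw [hcanon, hae]
      exact hpre i hi
    · rw [hcanon, hae]; exact hzero

end ReducedBridgeP

end CampaignW24

end Summit.ResolutionOfSingularities.ResolutionOfSingularities.Theorems

end
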